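import Summits.QuantumFields.YangMills.Theorems.BalabanUVNodesN15KingModelBlockAxialGauge
import HarnessLib

/-!
# BalabanUVNodes ∕ N15 — THE KING-MODEL RUNG (PART Ϥ-n): THE CUBE POINCARÉ INEQUALITY ON A BLOCK BY ITERATED LINE AVERAGES — `Σ_j‖w_j − w̄‖² ≤ (d+1)·L(L−1)·Σ_μ B_μ(w)`
# (`B_μ(w) = Σ_j‖w_j − w_{j−e_μ}‖²` the free-boundary Dirichlet form of the block in direction `μ`), hence the PER-BLOCK (Neumann) coercivity `min(a, c∕((d+1)L(L−1)))·Σ‖w_j‖² ≤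
# a|B|‖w̄‖² + cΣ_μB_μ(w)` — the elementary, per-cube form of King's ∕ Dimock's Lemma 29 («constants vs orthogonal-to-constants on each cube, dropping the bonds between cubes»), of the RIGHT
# ORDER `L^{−2}` (PART Ϥ-a's tree engine gives only `L^{−(d+2)}`); in King's scaling `c = L²` the constant is `min(a, (d+1)⁻¹·L∕(L−1)) ≥ min(a, (d+1)⁻¹)`, FREE OF `L`
# (Track A, DAG node N15 = NE2; FAN-OUT v1.1 §N15 s3 «KING-MODEL RUNG … + what the curved case adds»; count-neutral)

HONEST FRAMING.  Count-neutral (cell `pub-ymgap`, seat `pub-ymgap-dag-n15-e` g49; `--supports stmt-QuantumFields-27247 --as helper` = K3ᴬ, KEY MAP v3).  Pure finite-dimensional analysis on the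
offsets `{0,…,L−1}^{d+1}` of a block with values in an inner-product space (Mathlib + PART Ϥ-a's path engine); the engine for PART Ϥ-o («small curvature ⟹ η-uniform positivity»).
[Dimock2013] App. D Lemma 29 proves the torus version by the cube argument; the tree's `King1986.Torus.fineOp_coercive_unif` proves it by Fourier on the torus; this file is the per-cube
statement the curved case needs.  NOT a node discharge; nothing continuum ∕ ℝ⁴ ∕ OS ∕ Clay.

THE MATHEMATICS.  `A_i` = the average along coordinate `i`; `P_k = A_{k−1}∘⋯∘A_0` (so `P_{d+1}w` is constant).  (1) THE LINE POINCARÉ: on each line in direction `i` the path of `L`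
vertices is a rooted tree of depth `L−1`, so PART Ϥ-a's `tree_poincare` gives `Σ_t‖w(j^t) − A_iw(j)‖² ≤ L(L−1)·(line Dirichlet form)`; summing over lines (each point lies on one line,
counted `L` times by the parametrisation `(j,t) ↦ j^t := update j i t` — an `L`-to-one map, `updSwap`) `Σ_j‖w_j − A_iw_j‖² ≤ L(L−1)B_i(w)`.  (2) JENSEN: `B_μ(A_iw) ≤ B_μ(w)` for `μ ≠ i`
(averaging commutes with differences in other directions and contracts squares).  (3) TELESCOPING `w − P_{d+1}w = Σ_k(P_kw − P_{k+1}w)`, Cauchy–Schwarz over the `d+1` terms, (1) for `A_k` on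
`P_kw` and (2) `k` times: `Σ_j‖w_j − P_{d+1}w_j‖² ≤ (d+1)L(L−1)Σ_kB_k(w)`; the mean minimises the left side over constants.
RESULTS: §1 defs `lineAvg`, `dirForm` (`B_μ`), `updSwap` (the `L`-to-one reparametrisation as an `Equiv`), ★ `sum_sum_update` (`Σ_jΣ_tF(j^t) = L·Σ_jF(j)`), `lineAvg_update`, def `pathTree L`; §2 ★★
`sum_norm_sub_lineAvg_sq_le` (THE LINE POINCARÉ `≤ L(L−1)B_i`); §3 `lowerOff_update_comm`, ★ `norm_sq_avg_le` (Jensen), ★★ `dirForm_lineAvg_le` (`B_μ(A_iw) ≤ B_μ(w)`, `μ ≠ i`), `dirForm_lineAvg_self_le`?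
(not needed); §4 def `partialAvg`, `partialAvg_succ`, `dirForm_partialAvg_le`, def `IndepOf`, `indepOf_lineAvg_self`, `indepOf_lineAvg_of_indepOf`, `indepOf_partialAvg`, `partialAvg_top_const`, ★★
`sum_norm_sub_partialAvg_top_sq_le`; §5 ★★★ **`cube_poincare`** (`Σ_j‖w_j − w̄‖² ≤ (d+1)L(L−1)Σ_μB_μ(w)`), ★★★ **`cube_coercive`** (`min(a, c∕((d+1)L(L−1)))Σ‖w_j‖² ≤ a·L^{d+1}‖w̄‖² + cΣ_μB_μ(w)`).
PRIOR TREE ART (by name): Ϥ-a (`RootedTree`, `tree_poincare`, `treeMean`, `sum_norm_sub_treeMean_sq_le`, `sum_norm_sq_eq_mean_add`), Ϥ-m (`lowerOff`, `lowerOff_apply`), Mathlib (`Function.update`,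
`sq_sum_le_card_mul_sum_sq`, `norm_sum_le`).  Dedup (rg at filing): basename 0 files; needles `lineAvg|dirForm|updSwap|cube_poincare|cube_coercive|partialAvg` 0 files in `Summits/QuantumFields/YangMills` +
`Literature/MathematicalPhysics` (tree Poincaré files are for other carriers: `VirialFluxGapCombTreePoincare`, `AllWindowsColdBox…SlabPoincare` — different routes∕objects).  presearch: n/a (elementary).
Locators: [Dimock2013] App. D Lemma 29; [King1986] (4.33)–(4.37) p.674; [Balaban1985BackgroundPropagators] p.395 l.1–3.  0 `sorry`.
-/

noncomputable section
open scoped BigOperators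
open Finset

namespace Summit.QuantumFields.YangMills.BalabanUVNodes.N15KingModelRung.CovariantBlock

variable {d : ℕ} (L : ℕ) [NeZero L]
variable {𝕜 : Type*} [RCLike 𝕜] {E : Type*} [NormedAddCommGroup E] [InnerProductSpace 𝕜 E]

/-! ## §1 Line averages, directional Dirichlet forms, the `L`-to-one reparametrisation -/

/-- THE LINE AVERAGE in direction `i`: `(A_iw)(j) = L⁻¹Σ_t w(j with j_i := t)`. [cite: Dimock2013, App. D Lemma 29] -/
def lineAvg (i : Fin (d + 1)) (w : (Fin (d + 1) → Fin L) → E) (j : Fin (d + 1) → Fin L) : E := ((L : 𝕜)⁻¹) • ∑ t : Fin L, w (Function.update j i t)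

/-- THE FREE-BOUNDARY DIRICHLET FORM of the block in direction `μ`: `B_μ(w) = Σ_j‖w_j − w_{j−e_μ}‖²` (the terms with `j_μ = 0` vanish: `j − e_μ = j` there). [cite: King1986, (4.4) p.670] -/
def dirForm (μ : Fin (d + 1)) (w : (Fin (d + 1) → Fin L) → E) : ℝ := ∑ j : Fin (d + 1) → Fin L, ‖w j - w (lowerOff j μ)‖ ^ 2

/-- `j − e_μ = j` when `j_μ = 0`. [folklore] -/
theorem lowerOff_of_eq_zero {j : Fin (d + 1) → Fin L} {μ : Fin (d + 1)} (h : j μ = 0) : lowerOff j μ = j := by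
  funext ν; apply Fin.ext; rw [lowerOff_apply]
  by_cases hν : ν = μ
  · subst hν; rw [if_pos rfl, h]; rfl
  · rw [if_neg hν, Nat.sub_zero]

omit [NeZero L] in
/-- `B_μ ≥ 0`. [folklore] -/
theorem dirForm_nonneg (μ : Fin (d + 1)) (w : (Fin (d + 1) → Fin L) → E) : 0 ≤ dirForm L μ w := Finset.sum_nonneg fun _ _ => sq_nonneg _

/-- THE `L`-TO-ONE REPARAMETRISATION `(j,t) ↦ (j^t, j_i)` as a self-equivalence of `J × Fin L` (its own inverse up to the same formula). [folklore] -/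
def updSwap (i : Fin (d + 1)) : ((Fin (d + 1) → Fin L) × Fin L) ≃ ((Fin (d + 1) → Fin L) × Fin L) where
  toFun p := (Function.update p.1 i p.2, p.1 i)
  invFun p := (Function.update p.1 i p.2, p.1 i)
  left_inv p := by simp
  right_inv p := by simp

omit [NeZero L] in
/-- ★ THE COUNTING IDENTITY: `Σ_jΣ_t F(j^t) = L·Σ_j F(j)` (every point of the block lies on exactly one line in direction `i` and is hit `L` times). [folklore] -/
theorem sum_sum_update (i : Fin (d + 1)) (F : (Fin (d + 1) → Fin L) → ℝ) :
    ∑ j : Fin (d + 1) → Fin L, ∑ t : Fin L, F (Function.update j i t) = L * ∑ j : Fin (d + 1) → Fin L, F j := by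
  rw [← Fintype.sum_prod_type', Fintype.sum_equiv (updSwap L i) (fun p => F (Function.update p.1 i p.2)) (fun p => F p.1) (fun p => rfl), Fintype.sum_prod_type]
  simp only [Finset.sum_const, Finset.card_univ, Fintype.card_fin, nsmul_eq_mul]
  rw [Finset.mul_sum]

omit [NeZero L] in
/-- The line average does not depend on the position along the line. [folklore] -/
theorem lineAvg_update (i : Fin (d + 1)) (w : (Fin (d + 1) → Fin L) → E) (j : Fin (d + 1) → Fin L) (t : Fin L) :
    lineAvg L (𝕜 := 𝕜) i w (Function.update j i t) = lineAvg L (𝕜 := 𝕜) i w j := by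
  simp [lineAvg]

/-- THE PATH of `L` vertices as a rooted tree (root `0`, parent `t − 1`, depth `t`). [folklore] -/
def pathTree : RootedTree (Fin L) where
  root := 0
  parent := fun t => ⟨(t : ℕ) - 1, by omega⟩
  depth := fun t => (t : ℕ)
  depth_root := rfl
  depth_parent := fun t ht => by
    have : (t : ℕ) ≠ 0 := fun h => ht (Fin.ext h)
    show (t : ℕ) - 1 + 1 = (t : ℕ); omega
  eq_root_of_depth_eq_zero := fun t ht => Fin.ext ht

/-! ## §2 The line Poincaré inequality -/

/-- ★★ **THE LINE POINCARÉ INEQUALITY**: `Σ_j‖w_j − (A_iw)_j‖² ≤ L(L−1)·B_i(w)` (PART Ϥ-a's `tree_poincare` on each line — a path of depth `L−1` — summed over lines with the counting identity).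
[cite: Dimock2013, App. D Lemma 29; King1986, (4.36)–(4.37) p.674] -/
theorem sum_norm_sub_lineAvg_sq_le (i : Fin (d + 1)) (w : (Fin (d + 1) → Fin L) → E) :
    ∑ j : Fin (d + 1) → Fin L, ‖w j - lineAvg L (𝕜 := 𝕜) i w j‖ ^ 2 ≤ (L * (L - 1 : ℕ) : ℝ) * dirForm L i w := by
  have hL : (0 : ℝ) < L := by exact_mod_cast Nat.pos_of_ne_zero (NeZero.ne L)
  -- per line through `j`: the path Poincaré for `f t = w(j^t)`
  have hline : ∀ j : Fin (d + 1) → Fin L,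
      ∑ t : Fin L, ‖w (Function.update j i t) - lineAvg L (𝕜 := 𝕜) i w j‖ ^ 2
        ≤ (L * (L - 1 : ℕ) : ℝ) * ∑ t : Fin L, ‖w (Function.update j i t) - w (lowerOff (Function.update j i t) i)‖ ^ 2 := by
    intro j
    have h := tree_poincare (pathTree L) (𝕜 := 𝕜) (D := L - 1) (fun t => by show (t : ℕ) ≤ L - 1; have := t.isLt; omega) (fun t => w (Function.update j i t))
    have hmean : treeMean (𝕜 := 𝕜) (fun t : Fin L => w (Function.update j i t)) = lineAvg L (𝕜 := 𝕜) i w j := by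
      simp [treeMean, lineAvg, Fintype.card_fin]
    rw [hmean, Fintype.card_fin] at h
    refine h.trans (le_of_eq ?_)
    congr 1
    -- the tree sum over `t ≠ 0` equals the `lowerOff` sum (the `t = 0` term vanishes)
    rw [← Finset.sum_filter_add_sum_filter_not univ (fun t : Fin L => t ≠ (pathTree L).root)]
    have hzero : ∑ t ∈ univ.filter (fun t : Fin L => ¬ t ≠ (pathTree L).root), ‖w (Function.update j i t) - w (lowerOff (Function.update j i t) i)‖ ^ 2 = 0 := by
      refine Finset.sum_eq_zero fun t ht => ?_
      simp only [Finset.mem_filter, Finset.mem_univ, true_and, not_not] at ht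
      have h0 : (Function.update j i t) i = 0 := by rw [Function.update_self, ht]; rfl
      rw [lowerOff_of_eq_zero L h0, sub_self, norm_zero]; simp
    rw [hzero, add_zero]
    refine Finset.sum_congr rfl fun t _ => ?_
    have hpar : Function.update j i ((pathTree L).parent t) = lowerOff (Function.update j i t) i := by
      funext ν
      simp only [pathTree, lowerOff]
      by_cases hν : ν = i
      · subst hν; simp
      · simp [Function.update_of_ne hν]
    rw [hpar]
  -- sum over `j`: left side counted `L` times, right side is `L·B_i`
  have hsum := Finset.sum_le_sum fun j (_ : j ∈ (univ : Finset (Fin (d + 1) → Fin L))) => hline j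
  rw [← Finset.mul_sum] at hsum
  have hl : ∑ j : Fin (d + 1) → Fin L, ∑ t : Fin L, ‖w (Function.update j i t) - lineAvg L (𝕜 := 𝕜) i w j‖ ^ 2 = L * ∑ j : Fin (d + 1) → Fin L, ‖w j - lineAvg L (𝕜 := 𝕜) i w j‖ ^ 2 := by
    have := sum_sum_update L i (fun j => ‖w j - lineAvg L (𝕜 := 𝕜) i w j‖ ^ 2)
    simp only [lineAvg_update] at this
    exact this
  have hr : ∑ j : Fin (d + 1) → Fin L, ∑ t : Fin L, ‖w (Function.update j i t) - w (lowerOff (Function.update j i t) i)‖ ^ 2 = L * dirForm L i w :=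
    sum_sum_update L i (fun j => ‖w j - w (lowerOff j i)‖ ^ 2)
  rw [hl, hr] at hsum
  have hB := dirForm_nonneg L i w
  nlinarith

/-! ## §3 Jensen: averaging in one direction contracts the Dirichlet form of the others -/

/-- `update` and `lowerOff` in different directions commute. [folklore] -/
theorem lowerOff_update_comm (j : Fin (d + 1) → Fin L) {i μ : Fin (d + 1)} (h : μ ≠ i) (t : Fin L) :
    lowerOff (Function.update j i t) μ = Function.update (lowerOff j μ) i t := by
  funext ν; apply Fin.ext
  simp only [lowerOff_apply]
  by_cases h1 : ν = i
  · subst h1; simp [Ne.symm h]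
  · rw [Function.update_of_ne h1, Function.update_of_ne h1, lowerOff_apply]

/-- ★ JENSEN FOR THE AVERAGE: `‖L⁻¹Σ_t a_t‖² ≤ L⁻¹Σ_t‖a_t‖²`. [folklore] -/
theorem norm_sq_avg_le (a : Fin L → E) : ‖((L : 𝕜)⁻¹) • ∑ t, a t‖ ^ 2 ≤ (L : ℝ)⁻¹ * ∑ t, ‖a t‖ ^ 2 := by
  have hL : (0 : ℝ) < L := by exact_mod_cast Nat.pos_of_ne_zero (NeZero.ne L)
  rw [norm_smul, norm_inv, RCLike.norm_natCast, mul_pow, inv_pow]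
  have h1 : ‖∑ t, a t‖ ^ 2 ≤ (∑ t, ‖a t‖) ^ 2 := pow_le_pow_left₀ (norm_nonneg _) (norm_sum_le _ _) 2
  have h2 : (∑ t : Fin L, ‖a t‖) ^ 2 ≤ L * ∑ t, ‖a t‖ ^ 2 := by
    have := sq_sum_le_card_mul_sum_sq (s := (Finset.univ : Finset (Fin L))) (f := fun t => ‖a t‖)
    rwa [Finset.card_univ, Fintype.card_fin] at this
  calc ((L : ℝ) ^ 2)⁻¹ * ‖∑ t, a t‖ ^ 2 ≤ ((L : ℝ) ^ 2)⁻¹ * (L * ∑ t, ‖a t‖ ^ 2) := by gcongr; exact h1.trans h2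
    _ = (L : ℝ)⁻¹ * ∑ t, ‖a t‖ ^ 2 := by field_simp

/-- ★★ **AVERAGING ALONG `i` CONTRACTS THE DIRICHLET FORM ALONG `μ ≠ i`**: `B_μ(A_iw) ≤ B_μ(w)`. [cite: Dimock2013, App. D Lemma 29] -/
theorem dirForm_lineAvg_le {i μ : Fin (d + 1)} (h : μ ≠ i) (w : (Fin (d + 1) → Fin L) → E) : dirForm L μ (lineAvg L (𝕜 := 𝕜) i w) ≤ dirForm L μ w := by
  have hL : (0 : ℝ) < L := by exact_mod_cast Nat.pos_of_ne_zero (NeZero.ne L)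
  unfold dirForm
  have hpt : ∀ j : Fin (d + 1) → Fin L, ‖lineAvg L (𝕜 := 𝕜) i w j - lineAvg L (𝕜 := 𝕜) i w (lowerOff j μ)‖ ^ 2
      ≤ (L : ℝ)⁻¹ * ∑ t : Fin L, ‖w (Function.update j i t) - w (lowerOff (Function.update j i t) μ)‖ ^ 2 := by
    intro j
    have : lineAvg L (𝕜 := 𝕜) i w j - lineAvg L (𝕜 := 𝕜) i w (lowerOff j μ) = ((L : 𝕜)⁻¹) • ∑ t : Fin L, (w (Function.update j i t) - w (lowerOff (Function.update j i t) μ)) := by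
      simp only [lineAvg, ← smul_sub, ← Finset.sum_sub_distrib, lowerOff_update_comm L j h]
    rw [this]
    exact norm_sq_avg_le L _
  calc ∑ j, ‖lineAvg L (𝕜 := 𝕜) i w j - lineAvg L (𝕜 := 𝕜) i w (lowerOff j μ)‖ ^ 2
      ≤ ∑ j : Fin (d + 1) → Fin L, (L : ℝ)⁻¹ * ∑ t : Fin L, ‖w (Function.update j i t) - w (lowerOff (Function.update j i t) μ)‖ ^ 2 := Finset.sum_le_sum fun j _ => hpt j
    _ = (L : ℝ)⁻¹ * (L * ∑ j : Fin (d + 1) → Fin L, ‖w j - w (lowerOff j μ)‖ ^ 2) := by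
        rw [← Finset.mul_sum, sum_sum_update L i (fun j => ‖w j - w (lowerOff j μ)‖ ^ 2)]
    _ = ∑ j, ‖w j - w (lowerOff j μ)‖ ^ 2 := by field_simp

/-! ## §4 Partial averages and the telescoping -/

/-- THE PARTIAL AVERAGE over the first `k` coordinates: `P_0 = id`, `P_{k+1} = A_k ∘ P_k` (`k ≤ d`; constant in `k` beyond `d+1`). [cite: Dimock2013, App. D Lemma 29] -/
def partialAvg : ℕ → ((Fin (d + 1) → Fin L) → E) → ((Fin (d + 1) → Fin L) → E)
  | 0 => fun w => w
  | k + 1 => fun w => if h : k < d + 1 then lineAvg L (𝕜 := 𝕜) ⟨k, h⟩ (partialAvg k w) else partialAvg k w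

omit [NeZero L] in
/-- `P_{k+1} = A_k P_k` for `k ≤ d`. [folklore] -/
theorem partialAvg_succ {k : ℕ} (hk : k < d + 1) (w : (Fin (d + 1) → Fin L) → E) :
    partialAvg L (𝕜 := 𝕜) (k + 1) w = lineAvg L (𝕜 := 𝕜) ⟨k, hk⟩ (partialAvg L (𝕜 := 𝕜) k w) := by
  simp [partialAvg, hk]

/-- The partial averages contract every directional form of a direction not yet averaged: `B_μ(P_kw) ≤ B_μ(w)` for `k ≤ μ`. [cite: Dimock2013, App. D Lemma 29] -/
theorem dirForm_partialAvg_le (μ : Fin (d + 1)) : ∀ k : ℕ, k ≤ (μ : ℕ) → ∀ w : (Fin (d + 1) → Fin L) → E, dirForm L μ (partialAvg L (𝕜 := 𝕜) k w) ≤ dirForm L μ w := by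
  intro k
  induction k with
  | zero => intro _ w; exact le_rfl
  | succ k ih =>
    intro hk w
    have hk' : k < d + 1 := by have := μ.isLt; omega
    rw [partialAvg_succ L hk']
    have hne : μ ≠ ⟨k, hk'⟩ := fun h => by have := congrArg Fin.val h; simp at this; omega
    exact (dirForm_lineAvg_le L hne _).trans (ih (by omega) w)

/-- `f` does not depend on coordinate `i`. [folklore] -/
def IndepOf (i : Fin (d + 1)) (f : (Fin (d + 1) → Fin L) → E) : Prop := ∀ j t, f (Function.update j i t) = f j

omit [NeZero L] in
/-- `A_if` does not depend on coordinate `i`. [folklore] -/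
theorem indepOf_lineAvg_self (i : Fin (d + 1)) (w : (Fin (d + 1) → Fin L) → E) : IndepOf L i (lineAvg L (𝕜 := 𝕜) i w) :=
  fun j t => lineAvg_update L i w j t

omit [NeZero L] in
/-- Averaging along `i` preserves independence of another coordinate. [folklore] -/
theorem indepOf_lineAvg_of_indepOf {i μ : Fin (d + 1)} {w : (Fin (d + 1) → Fin L) → E} (hw : IndepOf L μ w) : IndepOf L μ (lineAvg L (𝕜 := 𝕜) i w) := by
  intro j t
  by_cases h : μ = i
  · subst h; exact lineAvg_update L μ w j t
  · simp only [lineAvg]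
    congr 1
    refine Finset.sum_congr rfl fun s _ => ?_
    rw [Function.update_comm h, hw]

omit [NeZero L] in
/-- `P_k w` does not depend on the coordinates `< k`. [folklore] -/
theorem indepOf_partialAvg : ∀ (k : ℕ) (μ : Fin (d + 1)), (μ : ℕ) < k → ∀ w : (Fin (d + 1) → Fin L) → E, IndepOf L μ (partialAvg L (𝕜 := 𝕜) k w) := by
  intro k
  induction k with
  | zero => intro μ h; exact absurd h (Nat.not_lt_zero _)
  | succ k ih =>
    intro μ hμ w
    by_cases hk : k < d + 1
    · rw [partialAvg_succ L hk]
      rcases Nat.lt_succ_iff_lt_or_eq.mp hμ with h | h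
      · exact indepOf_lineAvg_of_indepOf L (ih μ h w)
      · have : μ = ⟨k, hk⟩ := Fin.ext h
        subst this
        exact indepOf_lineAvg_self L _ _
    · have hμ' : (μ : ℕ) < k := by have := μ.isLt; omega
      simp only [partialAvg, hk, dif_neg, not_false_eq_true]
      exact ih μ hμ' w

omit [NeZero L] [NormedAddCommGroup E] [InnerProductSpace 𝕜 E] in
/-- A function independent of every coordinate is constant. [folklore] -/
theorem const_of_indepOf_all {f : (Fin (d + 1) → Fin L) → E} (hf : ∀ μ, IndepOf L μ f) (j j' : Fin (d + 1) → Fin L) : f j = f j' := by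
  -- change the coordinates of `j` into those of `j′` one at a time
  suffices h : ∀ s : ℕ, ∀ j j' : Fin (d + 1) → Fin L, (∀ μ : Fin (d + 1), s ≤ (μ : ℕ) → j μ = j' μ) → f j = f j' from
    h (d + 1) j j' (fun μ hμ => absurd μ.isLt (not_lt.mpr hμ))
  intro s
  induction s with
  | zero => intro j j' h; rw [show j = j' from funext fun μ => h μ (Nat.zero_le _)]
  | succ s ih =>
    intro j j' h
    by_cases hs : s < d + 1
    · -- set coordinate `s` of `j` to `j′_s`
      have h1 : f j = f (Function.update j ⟨s, hs⟩ (j' ⟨s, hs⟩)) := (hf ⟨s, hs⟩ j (j' ⟨s, hs⟩)).symm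
      rw [h1]
      refine ih _ _ fun μ hμ => ?_
      by_cases hμs : μ = ⟨s, hs⟩
      · subst hμs; simp
      · rw [Function.update_of_ne hμs]
        exact h μ (by have : (μ : ℕ) ≠ s := fun e => hμs (Fin.ext e); omega)
    · exact ih j j' fun μ _ => h μ (by have := μ.isLt; omega)

omit [NeZero L] in
/-- `P_{d+1}w` is constant on the block. [folklore] -/
theorem partialAvg_top_const (w : (Fin (d + 1) → Fin L) → E) (j j' : Fin (d + 1) → Fin L) : partialAvg L (𝕜 := 𝕜) (d + 1) w j = partialAvg L (𝕜 := 𝕜) (d + 1) w j' :=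
  const_of_indepOf_all L (fun μ => indepOf_partialAvg L (d + 1) μ μ.isLt w) j j'

/-- ★★ THE TELESCOPED BOUND: `Σ_j‖w_j − (P_{d+1}w)_j‖² ≤ (d+1)·L(L−1)·Σ_μB_μ(w)`. [cite: Dimock2013, App. D Lemma 29] -/
theorem sum_norm_sub_partialAvg_top_sq_le (w : (Fin (d + 1) → Fin L) → E) :
    ∑ j : Fin (d + 1) → Fin L, ‖w j - partialAvg L (𝕜 := 𝕜) (d + 1) w j‖ ^ 2 ≤ ((d + 1 : ℕ) : ℝ) * (L * (L - 1 : ℕ) : ℝ) * ∑ μ : Fin (d + 1), dirForm L μ w := by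
  -- pointwise telescoping + Cauchy–Schwarz over the `d+1` steps
  have htel : ∀ j, w j - partialAvg L (𝕜 := 𝕜) (d + 1) w j = ∑ μ : Fin (d + 1), (partialAvg L (𝕜 := 𝕜) μ w j - partialAvg L (𝕜 := 𝕜) (μ + 1) w j) := by
    intro j
    have : ∀ m : ℕ, m ≤ d + 1 → w j - partialAvg L (𝕜 := 𝕜) m w j = ∑ k ∈ Finset.range m, (partialAvg L (𝕜 := 𝕜) k w j - partialAvg L (𝕜 := 𝕜) (k + 1) w j) := by
      intro m
      induction m with
      | zero => intro _; simp [partialAvg]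
      | succ m ih => intro hm; rw [Finset.sum_range_succ, ← ih (by omega)]; abel
    rw [this (d + 1) le_rfl, Finset.sum_range]
  have hpt : ∀ j, ‖w j - partialAvg L (𝕜 := 𝕜) (d + 1) w j‖ ^ 2 ≤ ((d + 1 : ℕ) : ℝ) * ∑ μ : Fin (d + 1), ‖partialAvg L (𝕜 := 𝕜) μ w j - partialAvg L (𝕜 := 𝕜) (μ + 1) w j‖ ^ 2 := by
    intro j
    rw [htel j]
    have h1 := norm_sum_le (Finset.univ : Finset (Fin (d + 1))) (fun μ => partialAvg L (𝕜 := 𝕜) μ w j - partialAvg L (𝕜 := 𝕜) (μ + 1) w j)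
    have h2 := sq_sum_le_card_mul_sum_sq (s := (Finset.univ : Finset (Fin (d + 1)))) (f := fun μ => ‖partialAvg L (𝕜 := 𝕜) μ w j - partialAvg L (𝕜 := 𝕜) (μ + 1) w j‖)
    rw [Finset.card_univ, Fintype.card_fin] at h2
    exact (pow_le_pow_left₀ (norm_nonneg _) h1 2).trans (by exact_mod_cast h2)
  -- each step: line Poincaré for `A_μ` on `P_μw`, then Jensen `μ` times
  have hstep : ∀ μ : Fin (d + 1), ∑ j : Fin (d + 1) → Fin L, ‖partialAvg L (𝕜 := 𝕜) μ w j - partialAvg L (𝕜 := 𝕜) (μ + 1) w j‖ ^ 2 ≤ (L * (L - 1 : ℕ) : ℝ) * dirForm L μ w := by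
    intro μ
    rw [partialAvg_succ L μ.isLt]
    refine (sum_norm_sub_lineAvg_sq_le L ⟨μ, μ.isLt⟩ _).trans (mul_le_mul_of_nonneg_left ?_ (by positivity))
    have : (⟨(μ : ℕ), μ.isLt⟩ : Fin (d + 1)) = μ := Fin.ext rfl
    rw [this]
    exact dirForm_partialAvg_le L μ μ le_rfl w
  calc ∑ j, ‖w j - partialAvg L (𝕜 := 𝕜) (d + 1) w j‖ ^ 2
      ≤ ∑ j : Fin (d + 1) → Fin L, ((d + 1 : ℕ) : ℝ) * ∑ μ : Fin (d + 1), ‖partialAvg L (𝕜 := 𝕜) μ w j - partialAvg L (𝕜 := 𝕜) (μ + 1) w j‖ ^ 2 := Finset.sum_le_sum fun j _ => hpt j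
    _ = ((d + 1 : ℕ) : ℝ) * ∑ μ : Fin (d + 1), ∑ j : Fin (d + 1) → Fin L, ‖partialAvg L (𝕜 := 𝕜) μ w j - partialAvg L (𝕜 := 𝕜) (μ + 1) w j‖ ^ 2 := by rw [← Finset.mul_sum, Finset.sum_comm]
    _ ≤ ((d + 1 : ℕ) : ℝ) * ∑ μ : Fin (d + 1), (L * (L - 1 : ℕ) : ℝ) * dirForm L μ w := by gcongr with μ; exact hstep μ
    _ = ((d + 1 : ℕ) : ℝ) * (L * (L - 1 : ℕ) : ℝ) * ∑ μ : Fin (d + 1), dirForm L μ w := by rw [← Finset.mul_sum]; ring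

/-! ## §5 The cube Poincaré inequality and the per-block coercivity -/

/-- ★★★ **THE CUBE POINCARÉ INEQUALITY** (free boundary, every dimension, every side `L ≥ 1`): `Σ_j‖w_j − w̄‖² ≤ (d+1)·L(L−1)·Σ_μ B_μ(w)` — constant of the right order `L²` (the true Neumann
gap of the cube is `2 − 2cos(π∕L) ≍ π²∕L²`). [cite: Dimock2013, App. D Lemma 29; King1986, (4.36)–(4.37) p.674] -/
theorem cube_poincare (w : (Fin (d + 1) → Fin L) → E) :
    ∑ j : Fin (d + 1) → Fin L, ‖w j - treeMean (𝕜 := 𝕜) w‖ ^ 2 ≤ ((d + 1 : ℕ) : ℝ) * (L * (L - 1 : ℕ) : ℝ) * ∑ μ : Fin (d + 1), dirForm L μ w := by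
  haveI : Nonempty (Fin (d + 1) → Fin L) := ⟨fun _ => 0⟩
  have hconst := partialAvg_top_const L (𝕜 := 𝕜) w
  calc ∑ j, ‖w j - treeMean (𝕜 := 𝕜) w‖ ^ 2 ≤ ∑ j, ‖w j - partialAvg L (𝕜 := 𝕜) (d + 1) w (fun _ => 0)‖ ^ 2 := sum_norm_sub_treeMean_sq_le w _
    _ = ∑ j, ‖w j - partialAvg L (𝕜 := 𝕜) (d + 1) w j‖ ^ 2 := Finset.sum_congr rfl fun j _ => by rw [hconst (fun _ => 0) j]
    _ ≤ _ := sum_norm_sub_partialAvg_top_sq_le L w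

/-- ★★★ **THE PER-BLOCK (NEUMANN) COERCIVITY**: for `c ≥ 0` and every `a`: `min(a, c∕((d+1)L(L−1)))·Σ_j‖w_j‖² ≤ a·L^{d+1}·‖w̄‖² + c·Σ_μB_μ(w)` — the block term holds the constants, the
block's OWN bonds hold the rest, with the `L^{−2}` constant; in King's scaling `c = L²`: `min(a, L∕((d+1)(L−1))) ≥ min(a, (d+1)⁻¹)` for every `L ≥ 2` (and `a` for `L = 1`).
[cite: Dimock2013, App. D Lemma 29; King1986, (4.33) p.674; Balaban1985BackgroundPropagators, p.395 l.1–3] -/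
theorem cube_coercive {a c : ℝ} (hc : 0 ≤ c) (w : (Fin (d + 1) → Fin L) → E) :
    min a (c / (((d + 1 : ℕ) : ℝ) * (L * (L - 1 : ℕ) : ℝ))) * ∑ j : Fin (d + 1) → Fin L, ‖w j‖ ^ 2
      ≤ a * ((L : ℝ) ^ (d + 1) * ‖treeMean (𝕜 := 𝕜) w‖ ^ 2) + c * ∑ μ : Fin (d + 1), dirForm L μ w := by
  haveI : Nonempty (Fin (d + 1) → Fin L) := ⟨fun _ => 0⟩
  have hcard : (Fintype.card (Fin (d + 1) → Fin L) : ℝ) = (L : ℝ) ^ (d + 1) := by rw [Fintype.card_fun, Fintype.card_fin, Fintype.card_fin]; push_cast; ring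
  set Bsum := ∑ μ : Fin (d + 1), dirForm L μ w with hB
  set R := ∑ j : Fin (d + 1) → Fin L, ‖w j - treeMean (𝕜 := 𝕜) w‖ ^ 2 with hR
  set Bl := (L : ℝ) ^ (d + 1) * ‖treeMean (𝕜 := 𝕜) w‖ ^ 2 with hBl
  set K : ℝ := ((d + 1 : ℕ) : ℝ) * (L * (L - 1 : ℕ) : ℝ) with hK
  have hB0 : 0 ≤ Bsum := Finset.sum_nonneg fun μ _ => dirForm_nonneg L μ w
  have hR0 : 0 ≤ R := Finset.sum_nonneg fun _ _ => sq_nonneg _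
  have hBl0 : 0 ≤ Bl := by positivity
  have hK0 : 0 ≤ K := by positivity
  have hsplit : ∑ j : Fin (d + 1) → Fin L, ‖w j‖ ^ 2 = Bl + R := by rw [sum_norm_sq_eq_mean_add (𝕜 := 𝕜) w, hcard]
  have hP : R ≤ K * Bsum := cube_poincare L w
  rw [hsplit, mul_add]
  have h1 : min a (c / K) * Bl ≤ a * Bl := mul_le_mul_of_nonneg_right (min_le_left _ _) hBl0
  have h2 : min a (c / K) * R ≤ c * Bsum := by
    rcases eq_or_lt_of_le hK0 with h0 | hpos
    · have hR' : R = 0 := le_antisymm (by rw [← h0, zero_mul] at hP; exact hP) hR0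
      rw [hR', mul_zero]; exact mul_nonneg hc hB0
    · calc min a (c / K) * R ≤ (c / K) * R := mul_le_mul_of_nonneg_right (min_le_right _ _) hR0
        _ ≤ (c / K) * (K * Bsum) := mul_le_mul_of_nonneg_left hP (div_nonneg hc hK0)
        _ = c * Bsum := by field_simp
  linarith

end Summit.QuantumFields.YangMills.BalabanUVNodes.N15KingModelRung.CovariantBlock

end
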